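import Summits.HubbardSuperconductivity.HubbardLadder.Bounds.FdcEvalSums
import Summits.HubbardSuperconductivity.HubbardLadder.Bounds.FdcCert2x2A1
import Summits.HubbardSuperconductivity.HubbardLadder.Bounds.FdcCert2x2A2
import Summits.HubbardSuperconductivity.HubbardLadder.Bounds.FdcCert2x2B
import Summits.HubbardSuperconductivity.ManyBodyBootstrap.Bounds.E2.Defs
import HarnessLib

/-!
# Kernel theorem: `e(square-lattice Heisenberg AF) ≤ -0.6585041` from the finite-depth circuit `F31`

HONEST FRAMING: ladder R1–R4 with certified numbers; no claim on H/H₀; bounds for model classes,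
no materials claim.

`heisTL_fdc_upper_2x2 : HeisTorusFamilyUpper 2 6 (-6585041/10⁷)`: for every even `L ≥ 6` the ground
energy of the spin-½ Heisenberg antiferromagnet on the `L × L` torus is at most
`-0.6585041 · L²`. Proof: the abstract FDC variational bound `heisenbergTorus_groundEnergy_le_fdc`
(`E₀ ≤ k² Φ(φ, u)`, `L = 2k`, part `FdcTwoTilingEnergy`) at the circuit state `(phiHat, uHat)` of
`FdcEval2x2` (a `2×2`-cluster product vector dressed by one layer of commuting `2×2` dual-plaquette
unitaries, i.e. a translation-covariant depth-2 tensor-network state), the closed formula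
`fdcEnergy_phiHat_uHat` (part `FdcEvalSums`) and the 24 kernel-certified integer sums of parts
`FdcCert2x2A1/A2/B`; the final inequality is exact rational arithmetic (`norm_num`). All inputs are
theorems of the tree: no `native_decide`, no axioms beyond the standard ones, no hypotheses.
The value improves the cell's best thermodynamic-limit upper row (`-0.6510`, open 48×6 MPS cluster,
claim node) and lies `1.1 %` above the QMC value `-0.6694`; Tasaki (2020) §2.5. [folklore]
-/

namespace Summit.HubbardSuperconductivity.HubbardLadder.Bounds

open Matrix Finset Complex
open Literature.Probability.LatticeModels Literature.MathematicalPhysics.QuantumLattice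
open Summit.HubbardSuperconductivity.ManyBodyBootstrap.Bounds.E2

noncomputable section

/-- The A classes `(i, m)` (`pbit i m = 0`). [folklore] -/
theorem pbit_A : pbit 0 0 = 0 ∧ pbit 1 0 = 0 ∧ pbit 1 1 = 0 ∧ pbit 0 2 = 0 := by decide

/-- The B classes `(i, m)` (`pbit i m = 1`). [folklore] -/
theorem pbit_B : ¬pbit 0 1 = 0 ∧ ¬pbit 1 2 = 0 ∧ ¬pbit 0 3 = 0 ∧ ¬pbit 1 3 = 0 := by decide

/-- **`Φ(F31) ≤ 4 · (-0.6585041)`** (exact rational arithmetic on the 24 certified sums; the exact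
value is `Φ/4 = -0.65850416612…`). [folklore] -/
theorem fdcEnergy_phiHat_uHat_le :
    fdcEnergy 1 phiHat uHat ≤ 4 * (((-6585041 : ℚ) / 10000000 : ℚ) : ℝ) := by
  rw [fdcEnergy_phiHat_uHat, Fin.sum_univ_four, Fin.sum_univ_two, Fin.sum_univ_two,
    Fin.sum_univ_two, Fin.sum_univ_two]
  simp only [bondVal, if_pos pbit_A.1, if_pos pbit_A.2.1, if_pos pbit_A.2.2.1,
    if_pos pbit_A.2.2.2, if_neg pbit_B.1, if_neg pbit_B.2.1, if_neg pbit_B.2.2.1,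
    if_neg pbit_B.2.2.2, IAdir_eq_000, IAdir_eq_001, IAdir_eq_002, IAdir_eq_100, IAdir_eq_101,
    IAdir_eq_102, IAdir_eq_110, IAdir_eq_111, IAdir_eq_112, IAdir_eq_020, IAdir_eq_021,
    IAdir_eq_022, IB_eq_100, IB_eq_101, IB_eq_102, IB_eq_210, IB_eq_211, IB_eq_212, IB_eq_300,
    IB_eq_301, IB_eq_302, IB_eq_310, IB_eq_311, IB_eq_312, SCALE, N2]
  norm_num

/-- **D44 (kernel theorem).** Square-lattice spin-½ Heisenberg antiferromagnet, thermodynamic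
limit: `E₀(L × L torus) ≤ -0.6585041 · L²` for every even `L ≥ 6`, from the finite-depth-circuit
state `F31` (2×2 cluster product dressed by one layer of 2×2 dual-plaquette gates); with
`e = lim E₀/L²` this is `e ≤ -0.6585041`. Tasaki (2020) §2.5. [folklore] -/
theorem heisTL_fdc_upper_2x2 : HeisTorusFamilyUpper 2 6 ((-6585041 : ℚ) / 10000000) := by
  intro L _ h2 h6
  obtain ⟨k, hk2⟩ := h2
  have hkL : k * 2 = L := by omega
  have hk : 3 ≤ k := by omega
  haveI : NeZero k := ⟨by omega⟩
  have hE := heisenbergTorus_groundEnergy_le_fdc (k := k) (L := L) 1 1 hk hkL phiHat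
    star_phiHat_dotProduct_phiHat uHat conjTranspose_uHat_mul_uHat
  have hk0 : (0 : ℝ) ≤ 1 * (k : ℝ) ^ 2 := by positivity
  calc (heisenbergHamiltonian 1 (torusGraph 2 L) 1).groundEnergy
      ≤ 1 * (k : ℝ) ^ 2 * fdcEnergy 1 phiHat uHat := hE
    _ ≤ 1 * (k : ℝ) ^ 2 * (4 * (((-6585041 : ℚ) / 10000000 : ℚ) : ℝ)) :=
      mul_le_mul_of_nonneg_left fdcEnergy_phiHat_uHat_le hk0
    _ = (((-6585041 : ℚ) / 10000000 : ℚ) : ℝ) * (L : ℝ) ^ 2 := by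
      rw [← hkL]; push_cast; ring

end

end Summit.HubbardSuperconductivity.HubbardLadder.Bounds
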